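import Literature.NumberTheory.LFunctions.Zhang2022.Section3SigmaMajorant
import Literature.NumberTheory.LFunctions.Zhang2022.Section3Lemma36
import HarnessLib

/-!
# Zhang (2022) §3, Lemma 3.6 by the PRINTED route (subconvex binder explicit), side by side with
# the input-free route — the §3 chain to Lemma 3.6 closed both ways (kernel-checked)

Topic `Literature/NumberTheory/LFunctions/Zhang2022` (Landau–Siegel autopsy tree; verdict-neutral;
cell framing: audit + repair census of Zhang arXiv:2211.02515; no claim about Landau–Siegel).
Y. Zhang, *Discrete mean estimates and the Landau–Siegel zero*, arXiv:2211.02515v1 — **an unrefereed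
manuscript, a claimed result under adjudication** — §3 [p. 7 of the held text], proof of Lemma 3.6:

> "`|ς(n)| ≤ ∑_{n = lm} ν(l)|υ(m)| ≤ ν(n)τ₂(n)`. … Assume that (A) holds. By Cauchy's inequality, the
> first assertion of Lemma 3.2 and Lemma 3.1,
> `∑_{ψ∈Ψ} (|X₄(D⁸,ψ)| + ∫_{D⁴}^{D⁸} |X₄(x,ψ)| dx/x)² ≪ 𝔓𝓛^{-2005}`. Thus we conclude
> **Lemma 3.6.** Assume that (A) holds. The inequality
> `|X₄(D⁸,ψ)| + ∫_{D⁴}^{D⁸} |X₄(x,ψ)| dx/x < 𝓛^{-633}`  (3.6)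
> holds for all but at most `O(𝔓𝓛^{-739})` characters `ψ` in `Ψ`."

The manuscript's argument for Lemma 3.6 runs: majorant `|ς| ≤ ντ₂` + Lemma 3.2 (the eight-`L`-factor
moment `∑_{D⁴<n≤D⁸} ν(n)²τ₂(n)²/n ≪ 𝓛⁻²⁰⁰⁷`, whose sketched proof shifts a contour past `ζ⁸L⁸` cut
at `D⁴` and therefore consumes a SUBCONVEX bound for `L(s,χ)` in the `D`-aspect — uncited in the
manuscript; the cell's flag F7, read as Burgess [IwaniecKowalski2004, Thm 12.9]) ⇒ the input
`E = ∑_{D⁴<n≤D⁸} ς(n)²/n ≪ 𝓛⁻²⁰⁰⁷` ⇒ (orthogonality + Cauchy–Schwarz + Chebyshev) Lemma 3.6.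
Every link of this chain is already a tree theorem:

* the input `E` by the PRINTED route, CONDITIONAL on an `L`-size binder —
  `SigmaMajorant.lemma_3_6_input_printed_of_halfLineBound` (critical-line bound
  `HalfLineBound χ μ b C₀ : ‖L(½+it,χ)‖ ≤ C₀D^μ(1+|t|)^b`, ANY `0 ≤ μ < ¼`),
  `…_of_burgessShape` (`BurgessShape χ ε C : ‖L(s,χ)‖ ≤ C‖s‖D^{3/16+ε}` on `re s = ½`, the printed
  shape of [IwaniecKowalski2004, Thm 12.9], `0 ≤ ε < 1/16`), `…_of_LBound` (the `re s = ¾` binder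
  `LBound χ κ b C_L` of the printed Lemma 3.2, `κ < 1/8`) — `Section3SigmaMajorant`;
* Lemma 3.6 from its input as a PARAMETER — `Lemma36.lemma_3_6_of_input` (`Section3Lemma36`).

This file composes them (the "printed-route twin" of `Lemma36.lemma_3_6`):

* `lemma_3_6_of_inputFamily` — for ANY side hypothesis `H D χ` and any constant `C₀`: if
  `E ≤ C₀(log D)⁻²⁰⁰⁷` holds for every primitive quadratic `χ` mod `D` with `log D ≥ 3` under (A) and
  `H D χ`, then for those `(D, χ)`, every `s₀` on the critical line and every finite set `M` of moduli
  `> D⁸` (`𝔓_M = ∑_{p∈M} p`): the second moment of the left side of (3.6) over primitive `ψ` is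
  `≤ 34C₀ 𝔓_M (log D)⁻²⁰⁰⁵` and (3.6) fails for at most `34C₀ 𝔓_M (log D)⁻⁷³⁹` primitive `ψ`
  (exponents `2005 = 2007 − 2`, `739 = 2005 − 2·633` as printed);
* **`lemma_3_6_printed_of_halfLineBound`** — Zhang's Lemma 3.6 AS PRINTED by the manuscript's OWN
  route, hence with the published subconvex bound entering as the binder `HalfLineBound χ μ b C₀`,
  any `0 ≤ μ < ¼` (Burgess `μ = 3/16 + ε`, Weyl `μ = 1/6 + ε` [PetrowYoung2023, Thm 1.1]);
  **`lemma_3_6_printed_of_burgessShape`** (the binder in the printed shape of IK Thm 12.9) and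
  **`lemma_3_6_printed_of_LBound`** (the binder of the printed Lemma 3.2 on `re s = ¾`);
* `lemma_3_6_two_routes` — the SAME printed Lemma 3.6 recorded twice in one conjunction: under (A)
  ALONE (`Lemma36.lemma_3_6`, input-free route of `Lemma36Input.lemma_3_6_input'`, the cell's ALT-1
  variant A11: `ν ∗ υ = δ`, Cauchy, a four-`L`-factor moment inside the convexity range) and under
  (A) + `HalfLineBound` (this file);
* `printedRoute_boundary` — bookkeeping of WHY the binder must be subconvex on the printed route: the
  interpolated `re s = ¾` exponent `κ(μ) = μ(½−μ)/(¾−μ)` is `< 1/8` iff `μ < ¼`, and the convexity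
  exponent `μ = ¼` lands exactly on the boundary `κ = 1/8` that `Lemma32Cond.lemma_3_2_conditional`
  excludes (the tree's `kappaInterp_lt_one_eighth_iff`, `kappaInterp_one_quarter`) — flag F7 in one line.

WHAT THIS SAYS FOR THE CELL (ALT seat 1; census row V17 / note ALT1-R2 / flag F7; all verdict-neutral):
the manuscript's §3 argument for Lemma 3.6 is VALID AS WRITTEN once a `D`-aspect subconvex bound for
real primitive characters of ANY exponent `μ < ¼` is supplied (Burgess's 3/16 is one admissible choice,
not a necessary one), and the same printed Lemma 3.6 also holds with NO such input.  The subconvex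
input is therefore load-bearing for the ROUTE `|ς| ≤ ντ₂` only; no alternative character-sum input
(Burgess with explicit constants, Weyl-type, hybrid) changes any exponent of Lemma 3.6, and none
reaches the located gap of the manuscript ((8.24), `Section8Certificate.not_ineq824`), which is
downstream of §3 and independent of every analytic input.  Neither [IwaniecKowalski2004, Thm 12.9]
nor [PetrowYoung2023, Thm 1.1] is proved or asserted in this tree: they enter as binders only.  No
statement about the manuscript's Theorems 1–2 is made or implied.

## References

* Y. Zhang, arXiv:2211.02515 (2022), §3, Lemmas 3.1–3.3, 3.6 [p. 7].
  [cite: Zhang2022LandauSiegel, §3, Lemma 3.6]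
* H. Iwaniec, E. Kowalski, *Analytic Number Theory* (2004), Thm 12.9 (Burgess; shape of a binder only).
  [cite: IwaniecKowalski2004, Thm 12.9]
* I. Petrow, M. P. Young, *The fourth moment of Dirichlet L-functions along a coset and the Weyl
  bound*, Duke Math. J. 172 (2023), Thm 1.1 (Weyl exponent; shape of a binder only).
  [cite: PetrowYoung2023, Thm 1.1]
-/

noncomputable section

open Finset MeasureTheory ArithmeticFunction

namespace Literature.NumberTheory.LFunctions.Zhang2022.Lemma36Printed

open Literature.NumberTheory.LFunctions.Zhang2022 (sigmaTrunc nuOf upsilonOf)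
open Literature.NumberTheory.LFunctions.Zhang2022.Lemma36 (sigma36 lhs36 lemma_3_6_of_input
  lemma_3_6)
open Literature.NumberTheory.LFunctions.Zhang2022.SigmaMajorant
  (lemma_3_6_input_printed_of_halfLineBound lemma_3_6_input_printed_of_burgessShape
  lemma_3_6_input_printed_of_LBound)
open Literature.NumberTheory.LFunctions.Zhang2022.Lemma32Subconvex (HalfLineBound BurgessShape
  kappaInterp kappaInterp_lt_one_eighth_iff kappaInterp_one_quarter kappaInterp_burgess
  kappaInterp_weyl)
open Literature.NumberTheory.LFunctions.Zhang2022.Lemma32Cond (LBound)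
open Literature.NumberTheory.LFunctions.DirichletAbel (reChar)

/-! ### Lemma 3.6 from any route to its input -/

open scoped Classical in
/-- **Lemma 3.6 from ANY route to its input.**  Let `H D χ` be any side hypothesis and `C₀` any
constant such that `∑_{D⁴<n≤D⁸} ς(n)²/n ≤ C₀ (log D)⁻²⁰⁰⁷` for every `D` with `log D ≥ 3` and every
primitive `χ` mod `D` with `χ² = 1` satisfying (A) `‖L(1,χ)‖ ≤ (log D)⁻²⁰²²` and `H D χ`.  Then for
every such `(D, χ)`, every `s₀` with `re s₀ = ½` and every finite set `M` of moduli `> D⁸`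
(`𝔓_M = ∑_{p∈M} p`):
`∑_{p∈M} ∑*_{ψ mod p} (|X₄(D⁸,ψ)| + ∫_{D⁴}^{D⁸}|X₄(x,ψ)| dx/x)² ≤ 34C₀ 𝔓_M (log D)⁻²⁰⁰⁵` and the number
of primitive `ψ` violating (3.6) is `≤ 34C₀ 𝔓_M (log D)⁻⁷³⁹`.  (`H` trivial: `Lemma36.lemma_3_6`;
`H = HalfLineBound χ μ b C`: the printed route below.)  [cite: Zhang2022LandauSiegel, §3, Lemma 3.6] -/
theorem lemma_3_6_of_inputFamily (H : ∀ (D : ℕ) [NeZero D], DirichletCharacter ℂ D → Prop) {C₀ : ℝ}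
    (hC₀ : ∀ (D : ℕ) [NeZero D] (χ : DirichletCharacter ℂ D),
      χ.IsPrimitive → χ ^ 2 = 1 → 3 ≤ Real.log D → ‖χ.LFunction 1‖ ≤ 1 / Real.log D ^ 2022 →
      H D χ →
        ∑ n ∈ Ioc (D ^ 4) (D ^ 8),
          sigmaTrunc (nuOf (reChar χ)) (upsilonOf (reChar χ)) (D ^ 4) n ^ 2 / n ≤
            C₀ / Real.log D ^ 2007)
    (D : ℕ) [NeZero D] (χ : DirichletCharacter ℂ D) (hprim : χ.IsPrimitive) (hχ : χ ^ 2 = 1)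
    (hlog : 3 ≤ Real.log D) (hA : ‖χ.LFunction 1‖ ≤ 1 / Real.log D ^ 2022) (hH : H D χ)
    (s₀ : ℂ) (hs₀ : s₀.re = 1 / 2) (M : Finset ℕ) (hM : ∀ p ∈ M, D ^ 8 < p) :
    (∑ p ∈ M, ∑ ψ : DirichletCharacter ℂ p with ψ.IsPrimitive, lhs36 χ s₀ ψ ^ 2 ≤
        34 * C₀ * (∑ p ∈ M, (p : ℝ)) / Real.log D ^ 2005) ∧
      ∑ p ∈ M, ((univ.filter fun ψ : DirichletCharacter ℂ p =>
          ψ.IsPrimitive ∧ 1 / Real.log D ^ 633 ≤ lhs36 χ s₀ ψ).card : ℝ) ≤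
        34 * C₀ * (∑ p ∈ M, (p : ℝ)) / Real.log D ^ 739 := by
  have hD : 0 < D := Nat.pos_of_ne_zero (NeZero.ne D)
  have hE : ∑ n ∈ Ioc (D ^ 4) (D ^ 8), sigma36 χ n ^ 2 / n ≤ C₀ / Real.log D ^ 2007 :=
    hC₀ D χ hprim hχ hlog hA hH
  obtain ⟨hmom, hcount⟩ := lemma_3_6_of_input χ hD (by linarith) hE s₀ hs₀ M hM
  have hℓ : 0 < Real.log D := by linarith
  set ℓ := Real.log D with hℓdef
  set 𝔓 := ∑ p ∈ M, (p : ℝ) with h𝔓def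
  have hℓ' : ℓ ≠ 0 := hℓ.ne'
  have h1 : 34 * ℓ ^ 2 * 𝔓 * (C₀ / ℓ ^ 2007) = 34 * C₀ * 𝔓 / ℓ ^ 2005 := by
    field_simp
  have h2 := hcount (1 / ℓ ^ 633) (one_div_pos.mpr (pow_pos hℓ 633))
  have h3 : 34 * ℓ ^ 2 * 𝔓 * (C₀ / ℓ ^ 2007) / (1 / ℓ ^ 633) ^ 2 = 34 * C₀ * 𝔓 / ℓ ^ 739 := by
    field_simp
  refine ⟨?_, ?_⟩
  · rw [← h1]; exact hmom
  · rw [← h3]; exact h2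

/-! ### Lemma 3.6 as printed, by the printed route -/

open scoped Classical in
/-- **Zhang's Lemma 3.6 AS PRINTED, by the manuscript's OWN route** (majorant `|ς| ≤ ντ₂` + the
printed Lemma 3.2 + Lemma 3.3(i) + Cauchy–Schwarz + Chebyshev), hence CONDITIONAL on the subconvex
input of the sketched proof of Lemma 3.2, entering as the critical-line binder
`HalfLineBound χ μ b C₀ : ‖L(½+it,χ)‖ ≤ C₀D^μ(1+|t|)^b` with ANY `0 ≤ μ < ¼` (Burgess `3/16+ε`, Weyl
`1/6+ε`, …).  For such `μ, b, C₀ > 0` there is `C` with: for every `D` (`log D ≥ 3`), every primitive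
`χ` mod `D` with `χ² = 1`, (A) `‖L(1,χ)‖ ≤ (log D)⁻²⁰²²` and `HalfLineBound χ μ b C₀`, every `s₀`
(`re s₀ = ½`; the manuscript's `½ + 2πit₀`) and every finite set `M` of moduli `> D⁸` (the
manuscript's primes `p ∼ P`, `P = exp 𝓛⁹`; `𝔓_M = ∑_{p∈M} p`):
`∑_{p∈M} ∑*_{ψ} (|X₄(D⁸,ψ)| + ∫_{D⁴}^{D⁸}|X₄(x,ψ)| dx/x)² ≤ C𝔓_M(log D)⁻²⁰⁰⁵`, and (3.6) fails for at
most `C𝔓_M(log D)⁻⁷³⁹` primitive `ψ`.  The published bound is NOT asserted: it is a binder.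
[cite: Zhang2022LandauSiegel, §3, Lemma 3.6 (proof: "|ς(n)| ≤ ν(n)τ₂(n) … by the first assertion of
Lemma 3.2 and Lemma 3.1")] -/
theorem lemma_3_6_printed_of_halfLineBound {μ : ℝ} (hμ0 : 0 ≤ μ) (hμ : μ < 1 / 4) (b : ℕ)
    {C₀ : ℝ} (hC₀ : 0 < C₀) :
    ∃ C : ℝ, ∀ (D : ℕ) [NeZero D] (χ : DirichletCharacter ℂ D),
    χ.IsPrimitive → χ ^ 2 = 1 → 3 ≤ Real.log D → ‖χ.LFunction 1‖ ≤ 1 / Real.log D ^ 2022 →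
    HalfLineBound χ μ b C₀ →
    ∀ s₀ : ℂ, s₀.re = 1 / 2 → ∀ M : Finset ℕ, (∀ p ∈ M, D ^ 8 < p) →
      (∑ p ∈ M, ∑ ψ : DirichletCharacter ℂ p with ψ.IsPrimitive, lhs36 χ s₀ ψ ^ 2 ≤
          C * (∑ p ∈ M, (p : ℝ)) / Real.log D ^ 2005) ∧
        ∑ p ∈ M, ((univ.filter fun ψ : DirichletCharacter ℂ p =>
            ψ.IsPrimitive ∧ 1 / Real.log D ^ 633 ≤ lhs36 χ s₀ ψ).card : ℝ) ≤
          C * (∑ p ∈ M, (p : ℝ)) / Real.log D ^ 739 := by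
  obtain ⟨C₁, hC₁⟩ := lemma_3_6_input_printed_of_halfLineBound hμ0 hμ b hC₀
  exact ⟨34 * C₁, fun D _ χ hprim hχ hlog hA hHL s₀ hs₀ M hM =>
    lemma_3_6_of_inputFamily (fun D _ χ => HalfLineBound χ μ b C₀) hC₁ D χ hprim hχ hlog hA hHL
      s₀ hs₀ M hM⟩

open scoped Classical in
/-- **The same with the binder in the printed shape of Burgess's theorem** [IwaniecKowalski2004,
Thm 12.9]: `BurgessShape χ ε C₁ : ‖L(s,χ)‖ ≤ C₁‖s‖D^{3/16+ε}` on `re s = ½`, any `0 ≤ ε < 1/16`,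
`C₁ > 0` — the cell's reading of the manuscript's uncited input (flag F7; ALT-1 variant A1).
Thm 12.9 is NOT proved or asserted here.  [cite: Zhang2022LandauSiegel, §3, Lemma 3.6;
IwaniecKowalski2004, Thm 12.9 (shape of the binder only)] -/
theorem lemma_3_6_printed_of_burgessShape {ε : ℝ} (hε0 : 0 ≤ ε) (hε : ε < 1 / 16) {C₁ : ℝ}
    (hC₁ : 0 < C₁) :
    ∃ C : ℝ, ∀ (D : ℕ) [NeZero D] (χ : DirichletCharacter ℂ D),
    χ.IsPrimitive → χ ^ 2 = 1 → 3 ≤ Real.log D → ‖χ.LFunction 1‖ ≤ 1 / Real.log D ^ 2022 →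
    BurgessShape χ ε C₁ →
    ∀ s₀ : ℂ, s₀.re = 1 / 2 → ∀ M : Finset ℕ, (∀ p ∈ M, D ^ 8 < p) →
      (∑ p ∈ M, ∑ ψ : DirichletCharacter ℂ p with ψ.IsPrimitive, lhs36 χ s₀ ψ ^ 2 ≤
          C * (∑ p ∈ M, (p : ℝ)) / Real.log D ^ 2005) ∧
        ∑ p ∈ M, ((univ.filter fun ψ : DirichletCharacter ℂ p =>
            ψ.IsPrimitive ∧ 1 / Real.log D ^ 633 ≤ lhs36 χ s₀ ψ).card : ℝ) ≤
          C * (∑ p ∈ M, (p : ℝ)) / Real.log D ^ 739 := by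
  obtain ⟨C₂, hC₂⟩ := lemma_3_6_input_printed_of_burgessShape hε0 hε hC₁
  exact ⟨34 * C₂, fun D _ χ hprim hχ hlog hA hB s₀ hs₀ M hM =>
    lemma_3_6_of_inputFamily (fun D _ χ => BurgessShape χ ε C₁) hC₂ D χ hprim hχ hlog hA hB
      s₀ hs₀ M hM⟩

open scoped Classical in
/-- **The same under the binder of the printed Lemma 3.2 itself**: `LBound χ κ b C_L :
‖L(s,χ)‖ ≤ C_L D^κ (1+|im s|)^b` on `re s = ¾`, any `κ < 1/8`, `C_L ≥ 0` (the hypothesis of the tree's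
`Lemma32Cond.lemma_3_2_conditional`; `κ = 1/8`, the convexity / Pólya–Vinogradov strength, is the
excluded boundary).  [cite: Zhang2022LandauSiegel, §3, Lemmas 3.2, 3.6] -/
theorem lemma_3_6_printed_of_LBound {κ : ℝ} (hκ : κ < 1 / 8) (b : ℕ) {CL : ℝ} (hCL : 0 ≤ CL) :
    ∃ C : ℝ, ∀ (D : ℕ) [NeZero D] (χ : DirichletCharacter ℂ D),
    χ.IsPrimitive → χ ^ 2 = 1 → 3 ≤ Real.log D → ‖χ.LFunction 1‖ ≤ 1 / Real.log D ^ 2022 →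
    LBound χ κ b CL →
    ∀ s₀ : ℂ, s₀.re = 1 / 2 → ∀ M : Finset ℕ, (∀ p ∈ M, D ^ 8 < p) →
      (∑ p ∈ M, ∑ ψ : DirichletCharacter ℂ p with ψ.IsPrimitive, lhs36 χ s₀ ψ ^ 2 ≤
          C * (∑ p ∈ M, (p : ℝ)) / Real.log D ^ 2005) ∧
        ∑ p ∈ M, ((univ.filter fun ψ : DirichletCharacter ℂ p =>
            ψ.IsPrimitive ∧ 1 / Real.log D ^ 633 ≤ lhs36 χ s₀ ψ).card : ℝ) ≤
          C * (∑ p ∈ M, (p : ℝ)) / Real.log D ^ 739 := by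
  obtain ⟨C₂, hC₂⟩ := lemma_3_6_input_printed_of_LBound hκ b hCL
  exact ⟨34 * C₂, fun D _ χ hprim hχ hlog hA hLB s₀ hs₀ M hM =>
    lemma_3_6_of_inputFamily (fun D _ χ => LBound χ κ b CL) hC₂ D χ hprim hχ hlog hA hLB
      s₀ hs₀ M hM⟩

/-! ### The two routes side by side, and the boundary of the printed one -/

open scoped Classical in
/-- **Zhang's Lemma 3.6 as printed, by the two routes, in one conjunction.**  (i) Under (A) ALONE —
the tree's `Lemma36.lemma_3_6` (input-free: `Lemma36Input.lemma_3_6_input'`, ALT-1 variant A11; no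
`L`-size hypothesis of any kind).  (ii) Under (A) and the critical-line binder `HalfLineBound χ μ b C₀`
with `μ < ¼` — `lemma_3_6_printed_of_halfLineBound`, the manuscript's own route.  Same statement, same
printed exponents `2005 / 633 / 739`; the binder is carried by (ii) and absent from (i).
Verdict-neutral.  [cite: Zhang2022LandauSiegel, §3, Lemma 3.6] -/
theorem lemma_3_6_two_routes {μ : ℝ} (hμ0 : 0 ≤ μ) (hμ : μ < 1 / 4) (b : ℕ) {C₀ : ℝ}
    (hC₀ : 0 < C₀) :
    (∃ C : ℝ, ∀ (D : ℕ) [NeZero D] (χ : DirichletCharacter ℂ D),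
      χ.IsPrimitive → χ ^ 2 = 1 → 3 ≤ Real.log D → ‖χ.LFunction 1‖ ≤ 1 / Real.log D ^ 2022 →
      ∀ s₀ : ℂ, s₀.re = 1 / 2 → ∀ M : Finset ℕ, (∀ p ∈ M, D ^ 8 < p) →
        (∑ p ∈ M, ∑ ψ : DirichletCharacter ℂ p with ψ.IsPrimitive, lhs36 χ s₀ ψ ^ 2 ≤
            C * (∑ p ∈ M, (p : ℝ)) / Real.log D ^ 2005) ∧
          ∑ p ∈ M, ((univ.filter fun ψ : DirichletCharacter ℂ p =>
              ψ.IsPrimitive ∧ 1 / Real.log D ^ 633 ≤ lhs36 χ s₀ ψ).card : ℝ) ≤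
            C * (∑ p ∈ M, (p : ℝ)) / Real.log D ^ 739) ∧
    (∃ C : ℝ, ∀ (D : ℕ) [NeZero D] (χ : DirichletCharacter ℂ D),
      χ.IsPrimitive → χ ^ 2 = 1 → 3 ≤ Real.log D → ‖χ.LFunction 1‖ ≤ 1 / Real.log D ^ 2022 →
      HalfLineBound χ μ b C₀ →
      ∀ s₀ : ℂ, s₀.re = 1 / 2 → ∀ M : Finset ℕ, (∀ p ∈ M, D ^ 8 < p) →
        (∑ p ∈ M, ∑ ψ : DirichletCharacter ℂ p with ψ.IsPrimitive, lhs36 χ s₀ ψ ^ 2 ≤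
            C * (∑ p ∈ M, (p : ℝ)) / Real.log D ^ 2005) ∧
          ∑ p ∈ M, ((univ.filter fun ψ : DirichletCharacter ℂ p =>
              ψ.IsPrimitive ∧ 1 / Real.log D ^ 633 ≤ lhs36 χ s₀ ψ).card : ℝ) ≤
            C * (∑ p ∈ M, (p : ℝ)) / Real.log D ^ 739) :=
  ⟨lemma_3_6, lemma_3_6_printed_of_halfLineBound hμ0 hμ b hC₀⟩

/-- **Why the printed route's binder must be subconvex (flag F7 in one line).**  On the printed route
the critical-line exponent `μ` is interpolated to `κ(μ) = μ(½−μ)/(¾−μ)` at `re s = ¾`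
(`Lemma32Subconvex.kappaInterp`), and the printed Lemma 3.2 needs `κ < 1/8`: for `0 ≤ μ < 3/8` this
holds iff `μ < ¼`; the convexity exponent `μ = ¼` gives exactly the excluded boundary `κ = 1/8`, while
Burgess `3/16 ↦ 5/48` and Weyl `1/6 ↦ 2/21` are admissible.  (Bookkeeping of tree lemmas; the
input-free route `Lemma36.lemma_3_6` has no such threshold.)  [folklore] -/
theorem printedRoute_boundary :
    (∀ μ : ℝ, μ < 3 / 8 → (kappaInterp μ < 1 / 8 ↔ μ < 1 / 4)) ∧
      kappaInterp (1 / 4) = 1 / 8 ∧ kappaInterp (3 / 16) = 5 / 48 ∧ kappaInterp (1 / 6) = 2 / 21 ∧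
      (5 : ℝ) / 48 < 1 / 8 ∧ (2 : ℝ) / 21 < 1 / 8 :=
  ⟨fun _ hμ => kappaInterp_lt_one_eighth_iff hμ, kappaInterp_one_quarter, kappaInterp_burgess,
    kappaInterp_weyl, by norm_num, by norm_num⟩

end Literature.NumberTheory.LFunctions.Zhang2022.Lemma36Printed

end
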